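import Summits.KontsevichZagierPeriods.KontsevichZagierPeriods.Theses.LiftingCriteria
import Summits.KontsevichZagierPeriods.KontsevichZagierPeriods.Theorems.LiftingCriteriaDilationTransferDimOnePrimitiveNash
import Summits.KontsevichZagierPeriods.KontsevichZagierPeriods.Theorems.LiftingCriteriaDilationTransferDimOneMoves
import Summits.KontsevichZagierPeriods.KontsevichZagierPeriods.Theorems.HermiteRigidityRealEllipticSectorKernelStubReduction
import Literature.NumberTheory.Transcendental.KZSubcalculusInvariants
import Literature.NumberTheory.Transcendental.KZGroundingRelations
import Literature.NumberTheory.Transcendental.KZBetaChains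
import Literature.NumberTheory.Transcendental.KZBallPeelingAux

/-!
# `DilationTransfer` in dimension `≤ 1` — III. The transfer (crux stmt-KontsevichZagierPeriods-3572, special case)

Support file for crux `DilationTransfer` (stmt-KontsevichZagierPeriods-3572, route `LiftingCriteria`,
line `birth`): the crux `Summit.KontsevichZagierPeriods.KontsevichZagierPeriods.Theses.LiftingCriteria.DilationTransfer`
PROVED in the case where every integrand `gᵢ` and every witness function `Gⱼ` has dimension `≤ 1`
(registered sub-goal `stub_dilationTransferDimLeOne`; the hypotheses are those of the crux with
`∀ i, n i ≤ 1` added and `∀ j, d j ≤ 1` added inside the functional-relation witness).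

Mechanism (the one-dimensional dilation module `D(1) = {v | (ϖv)′ Nash}` of the route text, made a
theorem): read each datum along constant vectors, `γᵢ(y) = gᵢ(y,…,y)`; then
`v_{gᵢ}(ϖ) = ∫_{[0,1]^{nᵢ}} gᵢ(ϖz)dz = ϖ⁻¹ Pᵢ(ϖ)` with the primitive `Pᵢ = ∫₀ γᵢ`
(`integral_dilate_dim_le_one`, `integral_dilate_eq_inv_mul`), so the functional relation multiplied by
`ϖ` is the PRIMITIVE relation `m₀ϖ + Σ mᵢPᵢ(ϖ) = (ϖ − ϖ₀)(ϖμ₀(ϖ) + Σ μⱼ(ϖ)Qⱼ(ϖ))` on `(0,1)`; part I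
(`stub_dimOnePrimitiveNash`: polynomial-coefficient relations among primitives of Nash functions are
trivial modulo Nash functions) makes `P_f = m₀x + Σ mᵢPᵢ` `ℚ`-semialgebraic on `(0,1)`; the scaled
primitive `Π(s) = P_f(ϖ₀s)/ϖ₀` is continuous and `ℚ`-semialgebraic on `[0,1]` (end values `Π 0 = 0`,
`Π 1 = P_f(ϖ₀)/ϖ₀ = 0` by the relation AT `ϖ₀`) with `Π′ = f(ϖ₀·)`, `f = m₀ + Σ mᵢγᵢ`; hence the tame
representation `[[0,1]¹, f(ϖ₀z₀)]` is ONE Newton–Leibniz move from the zero point representation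
(`stub_dimOneNewtonLeibniz`, part II), and `m₀•[u] + Σ mᵢ•[rᵢ] ≡ [[0,1]¹, f(ϖ₀z₀)]` by reading each
`rᵢ` on `[0,1]¹` (`tame_read_dim_le_one`: congruence for `nᵢ = 1`, padding `tame_liftLast` for
`nᵢ = 0`), integer scaling (`reduction_of_constMul_int_sub_zsmul_mem_relations`) and integrand
additivity (`KZ.of_sub_sum_integrand_mem_relations`). No named fact is used: in dimension `≤ 1` the
transfer is unconditional. (In higher dimension the same transfer is the registered stub S1 of line
`birth`, of relative-Kontsevich–Zagier strength: see the skeleton `Cruxes/DilationTransfer/Lines/birth.lean`.)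

## References
* M. Kontsevich, D. Zagier, *Periods* (2001), §1.2 (rules (1)–(3)).
* J. Ayoub, *Periods and the conjectures of Grothendieck and Kontsevich–Zagier*, EMS Newsl. 91 (2014),
  Def. 10, Rem. 13 (tame cube representations).
-/

noncomputable section

open scoped BigOperators
open Set MeasureTheory Filter
open Literature.NumberTheory.Transcendental
open Literature.ModelTheory.ExponentialFields (IsSemialgebraic)

namespace Summit.KontsevichZagierPeriods.LiftingCriteria.DilationTransferDimOne
/-! ### The crux in dimension `≤ 1` -/

/-- **`DilationTransfer` in dimension `≤ 1`** (registered sub-goal `stub_dilationTransferDimLeOne`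
of crux stmt-KontsevichZagierPeriods-3572): the crux
`Summit.KontsevichZagierPeriods.KontsevichZagierPeriods.Theses.LiftingCriteria.DilationTransfer`
with all dimensions `nᵢ ≤ 1` and a functional-relation witness of dimensions `dⱼ ≤ 1`. Proof:
read every datum along constant vectors (`γᵢ(y) = gᵢ(y,…,y)`); the dilation functions are
`v_{gᵢ}(ϖ) = ϖ⁻¹ Pᵢ(ϖ)` with `Pᵢ = ∫₀ γᵢ` (`integral_dilate_dim_le_one`, `integral_dilate_eq_inv_mul`),
so the functional relation is the primitive relation of part I on `(0,1)`, and part I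
(`stub_dimOnePrimitiveNash`) makes `P_f = m₀ x + Σ mᵢ Pᵢ` `ℚ`-semialgebraic on `(0,1)`; the scaled
primitive `Π(s) = P_f(ϖ₀ s)/ϖ₀` is then continuous and `ℚ`-semialgebraic on `[0,1]` (rational end
values `0`, the value at `1` by the relation at `ϖ₀`) with `Π' = f(ϖ₀ ·)`, so the tame representation
`[[0,1]¹, f(ϖ₀ z₀)]` is ONE Newton–Leibniz move away from `[pt, 0]`
(`tame_of_mem_relations_of_primitive`); finally `m₀•[u] + Σ mᵢ•[rᵢ] ≡ [[0,1]¹, f(ϖ₀ z₀)]` by reading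
(`tame_read_dim_le_one`), integer scaling and integrand additivity. [cite: KontsevichZagier2001, §1.2] -/
theorem stub_dilationTransferDimLeOne :
    ∀ (S : ℕ) (n : Fin S → ℕ) (g : (i : Fin S) → (Fin (n i) → ℝ) → ℝ) (U : (i : Fin S) → Set (Fin (n i) → ℝ)), (∀ i, IsOpen (U i) ∧ Set.pi Set.univ (fun _ : Fin (n i) => Set.Icc (0:ℝ) 1) ⊆ (U i) ∧ Literature.NumberTheory.Transcendental.IsSemialgebraicFunOn ℚ (U i) (g i) ∧ AnalyticOnNhd ℝ (g i) (U i)) → (∀ i, n i ≤ 1) → ∀ (m : Fin S → ℤ) (m₀ : ℤ) (ϖ₀ : ℚ), 0 < ϖ₀ → ϖ₀ ≤ 1 → (∃ (T : ℕ) (d : Fin T → ℕ) (G : (j : Fin T) → (Fin (d j) → ℝ) → ℝ) (V : (j : Fin T) → Set (Fin (d j) → ℝ)) (μ : Fin T → Polynomial ℝ) (μ₀ : Polynomial ℝ), (∀ j, d j ≤ 1) ∧ (∀ j, IsOpen (V j) ∧ Set.pi Set.univ (fun _ : Fin (d j) => Set.Icc (0:ℝ) 1) ⊆ (V j) ∧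 Literature.NumberTheory.Transcendental.IsSemialgebraicFunOn ℚ (V j) (G j) ∧ AnalyticOnNhd ℝ (G j) (V j)) ∧ (∀ j k, IsAlgebraic ℚ ((μ j).coeff k)) ∧ (∀ k, IsAlgebraic ℚ (μ₀.coeff k)) ∧ ∀ ϖ ∈ Set.Icc (0:ℝ) 1, (m₀ : ℝ) + ∑ i, (m i : ℝ) * (∫ z in Set.pi Set.univ (fun _ : Fin (n i) => Set.Icc (0:ℝ) 1), g i (ϖ • z)) = (ϖ - (ϖ₀ : ℝ)) * (μ₀.eval ϖ + ∑ j, (μ j).eval ϖ * (∫ z in Set.pi Set.univ (fun _ : Fin (d j) => Set.Icc (0:ℝ) 1), G j (ϖ • z)))) → ∀ (r : (i : Fin S) → Literature.NumberTheory.Transcendental.KZ.IntegralRep (n i)) (u : Literature.NumberTheory.Transcendental.KZ.IntegralRep 0), (∀ i, (r i).domain = Set.pi Set.univ (fun _ : Fin (n i) => Set.Icc (0:ℝ) 1) ∧ ∀ z ∈ Set.pi Set.univ (fun _ : Fin (n i) => Set.Icc (0:ℝ) 1), (r i).integrand z = g i ((ϖ₀ : ℝ) • z)) → u.domain = Set.univ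 → (∀ x, u.integrand x = 1) → m₀ • Literature.NumberTheory.Transcendental.KZ.of u + ∑ i, m i • Literature.NumberTheory.Transcendental.KZ.of (r i) ∈ Literature.NumberTheory.Transcendental.KZ.relations := by
  intro S n g U hg hn m m₀ ϖ₀ hϖ0 hϖ1 hex r u hr hu1 hu2
  obtain ⟨T, d, G, V, μ, μ₀, hd, hG, hμ, hμ₀, hfun⟩ := hex
  have hϖ0' : (0:ℝ) < (ϖ₀ : ℝ) := by exact_mod_cast hϖ0
  have hϖ1' : (ϖ₀ : ℝ) ≤ 1 := by exact_mod_cast hϖ1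
  -- (1) one-variable readings `γᵢ(y) = gᵢ(y,…,y)`, analytic/continuous on open sets `⊇ [0,1]`
  set γ : Fin S → ℝ → ℝ := fun i y => g i (fun _ => y) with hγ
  set Γ : Fin T → ℝ → ℝ := fun j y => G j (fun _ => y) with hΓ
  have hconst_mem : ∀ (k : ℕ) (y : ℝ), y ∈ Set.Icc (0:ℝ) 1 →
      (fun _ : Fin k => y) ∈ Set.pi Set.univ (fun _ : Fin k => Set.Icc (0:ℝ) 1) :=
    fun k y hy => Set.mem_univ_pi.mpr fun _ => hy
  have hJo : ∀ i, IsOpen ((fun y : ℝ => (fun _ : Fin (n i) => y)) ⁻¹' U i) := fun i =>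
    (hg i).1.preimage (continuous_constVec _)
  have hJsub : ∀ i, Set.Icc (0:ℝ) 1 ⊆ (fun y : ℝ => (fun _ : Fin (n i) => y)) ⁻¹' U i :=
    fun i y hy => (hg i).2.1 (hconst_mem _ y hy)
  have hγa : ∀ i, AnalyticOnNhd ℝ (γ i) ((fun y : ℝ => (fun _ : Fin (n i) => y)) ⁻¹' U i) :=
    fun i y hy => analyticAt_comp_constVec ((hg i).2.2.2 _ hy)
  have hKo : ∀ j, IsOpen ((fun y : ℝ => (fun _ : Fin (d j) => y)) ⁻¹' V j) := fun j =>
    (hG j).1.preimage (continuous_constVec _)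
  have hKsub : ∀ j, Set.Icc (0:ℝ) 1 ⊆ (fun y : ℝ => (fun _ : Fin (d j) => y)) ⁻¹' V j :=
    fun j y hy => (hG j).2.1 (hconst_mem _ y hy)
  have hΓa : ∀ j, AnalyticOnNhd ℝ (Γ j) ((fun y : ℝ => (fun _ : Fin (d j) => y)) ⁻¹' V j) :=
    fun j y hy => analyticAt_comp_constVec ((hG j).2.2.2 _ hy)
  -- (2) primitives and the dilation functions
  set P : Fin S → ℝ → ℝ := fun i x => ∫ y in (0:ℝ)..x, γ i y with hP
  set Q : Fin T → ℝ → ℝ := fun j x => ∫ y in (0:ℝ)..x, Γ j y with hQ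
  have hPd : ∀ i, ∀ x ∈ Set.Icc (0:ℝ) 1, HasDerivAt (P i) (γ i x) x := fun i x hx =>
    hasDerivAt_primitive (hJo i) (hJsub i) (hγa i).continuousOn hx
  have hQd : ∀ j, ∀ x ∈ Set.Icc (0:ℝ) 1, HasDerivAt (Q j) (Γ j x) x := fun j x hx =>
    hasDerivAt_primitive (hKo j) (hKsub j) (hΓa j).continuousOn hx
  have hdil : ∀ i, ∀ ϖ : ℝ, 0 < ϖ →
      (∫ z in Set.pi Set.univ (fun _ : Fin (n i) => Set.Icc (0:ℝ) 1), g i (ϖ • z)) = ϖ⁻¹ * P i ϖ := by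
    intro i ϖ hϖ
    rw [integral_dilate_dim_le_one (hn i)]
    exact integral_dilate_eq_inv_mul (γ i) hϖ.ne'
  have hdilG : ∀ j, ∀ ϖ : ℝ, 0 < ϖ →
      (∫ z in Set.pi Set.univ (fun _ : Fin (d j) => Set.Icc (0:ℝ) 1), G j (ϖ • z)) = ϖ⁻¹ * Q j ϖ := by
    intro j ϖ hϖ
    rw [integral_dilate_dim_le_one (hd j)]
    exact integral_dilate_eq_inv_mul (Γ j) hϖ.ne'
  -- (3) the primitive form of the functional relation on `(0,1)` (and at `ϖ₀`)
  have hprim : ∀ x : ℝ, 0 < x → x ≤ 1 →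
      (m₀ : ℝ) * x + ∑ i, (m i : ℝ) * P i x = (x - (ϖ₀ : ℝ)) * (x * μ₀.eval x + ∑ j, (μ j).eval x * Q j x) := by
    intro x hx0 hx1
    have h := hfun x ⟨hx0.le, hx1⟩
    simp only [hdil _ x hx0, hdilG _ x hx0] at h
    have hx : x ≠ 0 := hx0.ne'
    have e1 : (m₀ : ℝ) * x + ∑ i, (m i : ℝ) * P i x = x * ((m₀ : ℝ) + ∑ i, (m i : ℝ) * (x⁻¹ * P i x)) := by
      rw [mul_add, Finset.mul_sum]
      congr 1
      · ring
      · exact Finset.sum_congr rfl fun i _ => by field_simp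
    have e2 : x * μ₀.eval x + ∑ j, (μ j).eval x * Q j x =
        x * (μ₀.eval x + ∑ j, (μ j).eval x * (x⁻¹ * Q j x)) := by
      rw [mul_add, Finset.mul_sum]
      congr 1
      exact Finset.sum_congr rfl fun j _ => by field_simp
    rw [e1, e2, h]
    ring
  have hPf0 : (m₀ : ℝ) * (ϖ₀ : ℝ) + ∑ i, (m i : ℝ) * P i (ϖ₀ : ℝ) = 0 := by
    rw [hprim _ hϖ0' hϖ1', sub_self, zero_mul]
  -- (4) part I: `P_f = m₀ x + Σ mᵢ Pᵢ` is `ℚ`-semialgebraic on `(0,1)`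
  have hIoo_sub : Set.Ioo (0:ℝ) 1 ⊆ Set.Icc (0:ℝ) 1 := Set.Ioo_subset_Icc_self
  have hnash : IsSemialgebraicFunOn ℚ {t : Fin 1 → ℝ | t 0 ∈ Set.Ioo (0:ℝ) 1}
      (fun t => (m₀ : ℝ) * t 0 + ∑ i, (m i : ℝ) * P i (t 0)) := by
    refine stub_dimOnePrimitiveNash S T γ Γ P Q m m₀ ϖ₀ μ μ₀ (fun i => ⟨?_, ?_, ?_⟩) (fun j => ⟨?_, ?_, ?_⟩)
      hμ hμ₀ (fun x hx => hprim x hx.1 hx.2.le)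
    · exact (hγa i).mono (hIoo_sub.trans (hJsub i))
    · simpa using isSemialgebraicFunOn_comp_constVec_mul (hg i).2.2.1 1 KZ.BallPeeling.isSemialgebraic_posIoo
        (fun t ht => (hg i).2.1 (hconst_mem _ _ (by simpa using hIoo_sub ht)))
    · exact fun x hx => hPd i x (hIoo_sub hx)
    · exact (hΓa j).mono (hIoo_sub.trans (hKsub j))
    · simpa using isSemialgebraicFunOn_comp_constVec_mul (hG j).2.2.1 1 KZ.BallPeeling.isSemialgebraic_posIoo
        (fun t ht => (hG j).2.1 (hconst_mem _ _ (by simpa using hIoo_sub ht)))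
    · exact fun x hx => hQd j x (hIoo_sub hx)
  -- (5) the scaled primitive `Π(s) = P_f(ϖ₀ s)/ϖ₀` and the integrand `f(y) = m₀ + Σ mᵢ γᵢ(y)`
  set f : ℝ → ℝ := fun y => (m₀ : ℝ) + ∑ i, (m i : ℝ) * γ i y with hf
  set Pr : ℝ → ℝ := fun s => (ϖ₀ : ℝ)⁻¹ * ((m₀ : ℝ) * ((ϖ₀ : ℝ) * s) + ∑ i, (m i : ℝ) * P i ((ϖ₀ : ℝ) * s))
    with hPr
  have hsc : ∀ s ∈ Set.Icc (0:ℝ) 1, (ϖ₀ : ℝ) * s ∈ Set.Icc (0:ℝ) 1 := fun s hs =>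
    ⟨mul_nonneg hϖ0'.le hs.1, mul_le_one₀ hϖ1' hs.1 hs.2⟩
  have hsc' : ∀ s ∈ Set.Ioo (0:ℝ) 1, (ϖ₀ : ℝ) * s ∈ Set.Ioo (0:ℝ) 1 := fun s hs =>
    ⟨mul_pos hϖ0' hs.1, by nlinarith [hs.2, hϖ1', hϖ0']⟩
  have hPrd : ∀ s ∈ Set.Icc (0:ℝ) 1, HasDerivAt Pr (f ((ϖ₀ : ℝ) * s)) s := by
    intro s hs
    have hin : HasDerivAt (fun s : ℝ => (ϖ₀ : ℝ) * s) ((ϖ₀ : ℝ) * 1) s := (hasDerivAt_id s).const_mul _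
    have hPi : ∀ i, HasDerivAt (fun s => P i ((ϖ₀ : ℝ) * s)) (γ i ((ϖ₀ : ℝ) * s) * ((ϖ₀ : ℝ) * 1)) s :=
      fun i => (hPd i _ (hsc s hs)).comp s hin
    have hsum : HasDerivAt (fun s => (m₀ : ℝ) * ((ϖ₀ : ℝ) * s) + ∑ i, (m i : ℝ) * P i ((ϖ₀ : ℝ) * s))
        ((m₀ : ℝ) * ((ϖ₀ : ℝ) * 1) + ∑ i, (m i : ℝ) * (γ i ((ϖ₀ : ℝ) * s) * ((ϖ₀ : ℝ) * 1))) s :=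
      (hin.const_mul _).add (HasDerivAt.fun_sum fun i _ => (hPi i).const_mul _)
    have hne : (ϖ₀ : ℝ) ≠ 0 := hϖ0'.ne'
    have hval : (ϖ₀ : ℝ)⁻¹ * ((m₀ : ℝ) * ((ϖ₀ : ℝ) * 1) +
        ∑ i, (m i : ℝ) * (γ i ((ϖ₀ : ℝ) * s) * ((ϖ₀ : ℝ) * 1))) = f ((ϖ₀ : ℝ) * s) := by
      rw [hf, mul_one, mul_add, Finset.mul_sum]
      congr 1
      · field_simp
      · exact Finset.sum_congr rfl fun i _ => by field_simp
    have h := hsum.const_mul ((ϖ₀ : ℝ)⁻¹)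
    rw [hval] at h
    exact h
  have hPrc : ContinuousOn Pr (Set.Icc (0:ℝ) 1) := fun s hs =>
    (hPrd s hs).continuousAt.continuousWithinAt
  have hPr0 : Pr 0 = 0 := by
    simp [hPr, hP, intervalIntegral.integral_same]
  have hPr1 : Pr 1 = 0 := by
    simp only [hPr, mul_one, hPf0, mul_zero]
  have hPrs_Ioo : IsSemialgebraicFunOn ℚ {t : Fin 1 → ℝ | t 0 ∈ Set.Ioo (0:ℝ) 1} (fun t => Pr (t 0)) := by
    have h1 : IsSemialgebraicFunOn ℚ {t : Fin 1 → ℝ | t 0 ∈ Set.Ioo (0:ℝ) 1}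
        (fun t => (m₀ : ℝ) * ((ϖ₀ : ℝ) * t 0) + ∑ i, (m i : ℝ) * P i ((ϖ₀ : ℝ) * t 0)) := by
      have h := isSemialgebraicFunOn_comp_constVec_mul (k := 1)
        (g := fun v : Fin 1 → ℝ => (m₀ : ℝ) * v 0 + ∑ i, (m i : ℝ) * P i (v 0)) hnash ϖ₀ KZ.BallPeeling.isSemialgebraic_posIoo
        (fun t ht => by simpa using hsc' _ ht)
      simpa using h
    exact ((isSemialgebraicFunOn_const_ratCast KZ.BallPeeling.isSemialgebraic_posIoo ϖ₀⁻¹).fun_mul h1).congr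
      fun t _ => by simp [hPr]
  have hPrs : IsSemialgebraicFunOn ℚ {t : Fin 1 → ℝ | t 0 ∈ Set.Icc (0:ℝ) 1} (fun t => Pr (t 0)) :=
    KZ.isSemialgebraicFunOn_Icc_of_Ioo hPrs_Ioo 0 0 (fun t ht => by rw [ht, hPr0, Rat.cast_zero])
      (fun t ht => by rw [ht, hPr1, Rat.cast_zero])
  -- (6) the tame representation `A = [[0,1]¹, f(ϖ₀ z₀)]` is a relation (one Newton–Leibniz move)
  have hfa1 : AnalyticOnNhd ℝ (fun z : Fin 1 → ℝ => f ((ϖ₀ : ℝ) * z 0)) (KZ.cube 1) := by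
    intro z hz
    have hy : (ϖ₀ : ℝ) * z 0 ∈ Set.Icc (0:ℝ) 1 := hsc _ ((KZ.mem_cube.mp hz) 0)
    have hγi : ∀ i, AnalyticAt ℝ (fun z : Fin 1 → ℝ => γ i ((ϖ₀ : ℝ) * z 0)) z := fun i =>
      analyticAt_comp_constVec_mul (ϖ₀ : ℝ) ((hg i).2.2.2 _ (hJsub i hy))
    simp only [hf]
    exact analyticAt_const.add (Finset.analyticAt_fun_sum _ fun i _ => analyticAt_const.mul (hγi i))
  have hfs1 : IsSemialgebraicFunOn ℚ (KZ.cube 1) (fun z : Fin 1 → ℝ => f ((ϖ₀ : ℝ) * z 0)) := by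
    have hγi : ∀ i, IsSemialgebraicFunOn ℚ (KZ.cube 1) (fun z : Fin 1 → ℝ => γ i ((ϖ₀ : ℝ) * z 0)) :=
      fun i => isSemialgebraicFunOn_comp_constVec_mul (hg i).2.2.1 ϖ₀ KZ.isSemialgebraic_cube
        (fun t ht => (hg i).2.1 (hconst_mem _ _ (hsc _ ((KZ.mem_cube.mp ht) 0))))
    simp only [hf]
    exact (isSemialgebraicFunOn_const_intCast KZ.isSemialgebraic_cube m₀).fun_add
      (IsSemialgebraicFunOn.fun_finsetSum _ KZ.isSemialgebraic_cube fun i _ =>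
        (isSemialgebraicFunOn_const_intCast KZ.isSemialgebraic_cube (m i)).fun_mul (hγi i))
  set A : KZ.IntegralRep 1 := KZ.IntegralRep.tameCube _ hfa1 hfs1 with hAdef
  have hAt : A.IsTameCube := KZ.IntegralRep.isTameCube_tameCube _ _ _
  have hA : KZ.of A ∈ KZ.relations :=
    stub_dimOneNewtonLeibniz _ _ hPrs hPrc (fun t ht => hPrd t (hIoo_sub ht)) (hPr1.trans hPr0.symm)
      A hAt (fun z _ => rfl)
  -- (7) tame one-variable readings of the given representations
  have hρa : ∀ i, AnalyticOnNhd ℝ (fun z : Fin 1 → ℝ => γ i ((ϖ₀ : ℝ) * z 0)) (KZ.cube 1) := fun i z hz =>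
    analyticAt_comp_constVec_mul (ϖ₀ : ℝ) ((hg i).2.2.2 _ (hJsub i (hsc _ ((KZ.mem_cube.mp hz) 0))))
  have hρs : ∀ i, IsSemialgebraicFunOn ℚ (KZ.cube 1) (fun z : Fin 1 → ℝ => γ i ((ϖ₀ : ℝ) * z 0)) :=
    fun i => isSemialgebraicFunOn_comp_constVec_mul (hg i).2.2.1 ϖ₀ KZ.isSemialgebraic_cube
      (fun t ht => (hg i).2.1 (hconst_mem _ _ (hsc _ ((KZ.mem_cube.mp ht) 0))))
  set ρ : Fin S → KZ.IntegralRep 1 := fun i => KZ.IntegralRep.tameCube _ (hρa i) (hρs i) with hρdef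
  have hρt : ∀ i, (ρ i).IsTameCube := fun i => KZ.IntegralRep.isTameCube_tameCube _ _ _
  have hρr : ∀ i, KZ.of (ρ i) - KZ.of (r i) ∈ KZ.relations := fun i =>
    tame_read_dim_le_one (hn i) (g i) (U i) (hg i).2.1 (hg i).2.2.1 (ϖ₀ : ℝ) (r i) (hr i).1 (hr i).2
      (ρ i) (hρt i) (fun z _ => rfl)
  -- the unit representation, read on `[0,1]¹`
  have hut : u.IsTameCube := by
    refine ⟨by rw [hu1, KZ.cube_zero], ?_⟩
    rw [show u.integrand = fun _ => 1 from funext hu2]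
    exact analyticOnNhd_const
  have h1s0 : IsSemialgebraicFunOn ℚ (KZ.cube 0) (fun _ : Fin 0 → ℝ => (1 : ℝ)) := by
    simpa using isSemialgebraicFunOn_const_natCast (KZ.isSemialgebraic_cube (n := 0)) 1
  have h1s1 : IsSemialgebraicFunOn ℚ (KZ.cube 1) (fun _ : Fin 1 → ℝ => (1 : ℝ)) := by
    simpa using isSemialgebraicFunOn_const_natCast (KZ.isSemialgebraic_cube (n := 1)) 1
  set One : KZ.IntegralRep 1 := KZ.IntegralRep.tameCube (fun _ => (1:ℝ)) analyticOnNhd_const h1s1 with hOne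
  have hOt : One.IsTameCube := KZ.IntegralRep.isTameCube_tameCube _ _ _
  have hOu : KZ.of One - KZ.of u ∈ KZ.relations :=
    Summit.KontsevichZagierPeriods.InverseLandau.TateFamilyKernel.tame_liftLast
      (u := fun _ : Fin 0 → ℝ => (1 : ℝ)) analyticOnNhd_const h1s0 One hOt (fun w _ => rfl) u hut
      (fun x _ => hu2 x)
  -- (8) recombination: scaled representations and integrand additivity
  set Rc : Option (Fin S) → KZ.IntegralRep 1 := fun o =>
    o.elim (One.constMul (m₀ : ℝ) (isAlgebraic_int m₀))
      (fun i => (ρ i).constMul (m i : ℝ) (isAlgebraic_int (m i))) with hRc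
  have hRc0 : Rc none = One.constMul (m₀ : ℝ) (isAlgebraic_int m₀) := rfl
  have hRcs : ∀ i, Rc (some i) = (ρ i).constMul (m i : ℝ) (isAlgebraic_int (m i)) := fun i => rfl
  have hsum : KZ.of A - ∑ o, KZ.of (Rc o) ∈ KZ.relations := by
    refine KZ.of_sub_sum_integrand_mem_relations Finset.univ Rc A (fun o _ => ?_) fun v _ => ?_
    · cases o with
      | none => rw [hRc0, KZ.IntegralRep.domain_constMul, hOt.1, hAt.1]
      | some i => rw [hRcs i, KZ.IntegralRep.domain_constMul, (hρt i).1, hAt.1]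
    · show A.integrand v = ∑ o, (Rc o).integrand v
      rw [Fintype.sum_option]
      simp only [hRc0, hRcs, KZ.IntegralRep.integrand_constMul, hAdef, hOne, hρdef,
        KZ.IntegralRep.tameCube_integrand, hf, mul_one]
  have hsc0 : KZ.of (Rc none) - m₀ • KZ.of One ∈ KZ.relations := by
    rw [hRc0]; exact Summit.KontsevichZagierPeriods.HermiteRigidity.RealEllipticSectorKernel.reduction_of_constMul_int_sub_zsmul_mem_relations One m₀
  have hsci : ∀ i, KZ.of (Rc (some i)) - m i • KZ.of (ρ i) ∈ KZ.relations := fun i => by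
    rw [hRcs i]; exact Summit.KontsevichZagierPeriods.HermiteRigidity.RealEllipticSectorKernel.reduction_of_constMul_int_sub_zsmul_mem_relations (ρ i) (m i)
  have step1 : KZ.of (Rc none) + ∑ i, KZ.of (Rc (some i)) ∈ KZ.relations := by
    have h := KZ.relations.sub_mem hA hsum
    rw [sub_sub_cancel, Fintype.sum_option] at h
    exact h
  have step2 : m₀ • KZ.of One + ∑ i, m i • KZ.of (ρ i) ∈ KZ.relations := by
    have h4 : ∑ i, (KZ.of (Rc (some i)) - m i • KZ.of (ρ i)) ∈ KZ.relations :=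
      KZ.relations.sum_mem fun i _ => hsci i
    have h := KZ.relations.sub_mem (KZ.relations.sub_mem step1 hsc0) h4
    have e : KZ.of (Rc none) + ∑ i, KZ.of (Rc (some i)) - (KZ.of (Rc none) - m₀ • KZ.of One) -
        ∑ i, (KZ.of (Rc (some i)) - m i • KZ.of (ρ i)) = m₀ • KZ.of One + ∑ i, m i • KZ.of (ρ i) := by
      rw [Finset.sum_sub_distrib]; abel
    rwa [e] at h
  have h5 : m₀ • (KZ.of One - KZ.of u) ∈ KZ.relations := KZ.relations.zsmul_mem hOu m₀
  have h6 : ∑ i, m i • (KZ.of (ρ i) - KZ.of (r i)) ∈ KZ.relations :=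
    KZ.relations.sum_mem fun i _ => KZ.relations.zsmul_mem (hρr i) (m i)
  have h := KZ.relations.sub_mem (KZ.relations.sub_mem step2 h5) h6
  have e : m₀ • KZ.of One + ∑ i, m i • KZ.of (ρ i) - m₀ • (KZ.of One - KZ.of u) -
      ∑ i, m i • (KZ.of (ρ i) - KZ.of (r i)) = m₀ • KZ.of u + ∑ i, m i • KZ.of (r i) := by
    simp only [zsmul_sub, Finset.sum_sub_distrib]; abel
  rwa [e] at h

end Summit.KontsevichZagierPeriods.LiftingCriteria.DilationTransferDimOne
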